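import Summits.QuantumFields.BalabanUV.T4Continuum.Support.SubstrateGaussianLettersBall

/-!
# T⁴ programme, spine estimate NE1′ (node O3b/H2) — THE CLASS OPERATOR RADIUS, LOCATED: the substrate's two displayed radius
# smallnesses `detBudget (card mI) β₀ ϑ R′ < d₀` (`hbud`) and `card mI · ϑ · R′ < γ` (`hmq`) hold at EVERY factor whose letters are
# uniformly bounded (`card mI ≤ m̄`, `β₀ ≤ β̄`, `ϑ ≤ ϑ̄`, `d̄ ≤ d₀`, `γ̄ ≤ γ`) as soon as the ONE radius `R′ ≤ 1` satisfies the TWO explicit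
# polynomial inequalities `m̄!·m̄·max 1 (β̄ + ϑ̄)^{m̄−1}·ϑ̄·R′ < d̄` and `m̄·ϑ̄·R′ < γ̄`

Cell `pub-balaban`, sub-cell `t4`, BINDER-OWNERS row NE1′ (owner lineage t4-ne1p-p1); NE1′ formalisation crew, unit
b2b-balaban-t4-ne1p-formalise-leaf-05, generation 13; crew row S67 ∕ DAG N29zzzzzr PART A of `t4/formal/NE1p/LEAVES.md` (INTENT `CLAIMS.log`
l.25153; BOOKED typer R-T155 l.25330; X248) — a SUPPLIER file (arithmetic only) for this lineage's S65 and crew S30 ∕ S31, under CREW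
custody (module name without the substrate lineage's `Substrate*` mark, R-T155).  ADDITIVE — imports the substrate's
`Support/SubstrateGaussianLettersBall` (p3; `detBudget`) ONLY; THEOREMS ONLY (0 `def`, 0 `def … : Prop`, 0 cite, 0 sorry); nothing of the substrate
restated.

WHY.  The substrate's S-U3 letters (`SubstrateGaussianLettersBall`, `B13AssemblyCoresEndSubstrateLetters`) and the crew's S30 ∕ S31 ∕ S65
DISPLAY, per level `k` and UNIFORMLY over all factors `(X, j)`, the two radius smallnesses
`hbud : detBudget (card (mI X j)) (β₀ X j) (ϑ X j) (R′ k) < d₀ X j` and `hmq : card (mI X j)·ϑ X j·R′ k < γ X j` — «NOT claimed, those stay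
DISPLAYED» (substrate letters file, header).  They are ARITHMETIC in the one number `R′ k`: `detBudget n β₀ ϑ R = n!·(n·(β₀ + ϑR)^{n−1}·ϑR)`
vanishes linearly at `R = 0`.  THIS FILE locates a sufficient radius: under uniform letter bounds the two families of inequalities follow
from TWO scalar inequalities on `R′ k` with an EXPLICIT polynomial threshold — so a consumer may display «`R′ k ≤ 1`,
`m̄!·m̄·max 1 (β̄+ϑ̄)^{m̄−1}·ϑ̄·R′ k < d̄`, `m̄·ϑ̄·R′ k < γ̄`» (three scalars per level) instead of two `∀ X j` families.
* §1 **`detBudget_le_located`** — for `n ≤ m̄`, `0 ≤ β₀ ≤ β̄`, `0 ≤ ϑ ≤ ϑ̄`, `0 ≤ R ≤ 1`: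
  `detBudget n β₀ ϑ R ≤ m̄!·m̄·max 1 (β̄ + ϑ̄)^{m̄−1}·ϑ̄·R` (factorial ∕ power monotonicity; the `max 1` makes the power monotone in the
  exponent).  **`detBudget_lt_located`** — hence `detBudget n β₀ ϑ R < d₀` from `m̄!·m̄·max 1 (β̄+ϑ̄)^{m̄−1}·ϑ̄·R < d̄ ≤ d₀`.
* §2 **`card_mul_radius_lt_located`** — `n·ϑ·R < γ` from `n ≤ m̄`, `0 ≤ ϑ ≤ ϑ̄`, `0 ≤ R`, `m̄·ϑ̄·R < γ̄ ≤ γ`.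
* §3 **`hbud_hmq_located`** — the two DISPLAYED families of S30 ∕ S65 (`∀ k X j, detBudget (card (mI X j)) (β₀ X j) (ϑ X j) (R′ k) < d₀ X j`
  and `∀ k X j, card (mI X j)·ϑ X j·R′ k < γ X j`) from uniform letter bounds and the three scalar clauses per level, for ANY index types.

HONEST FRAMING.  Elementary real arithmetic ([folklore]); no estimate of print; nothing about WHICH radius Bałaban's classes carry (the
class radii are (w6)-type bookkeeping of the owner's skeleton, C-t4r2-363 (iii)) — this only says the substrate's two smallness DISPLAYS are
met by every radius below an explicit threshold in the letters' uniform bounds; whether the datum of record HAS uniformly bounded letters is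
the substrate's ∕ rows NE2–NE3's business, NOT claimed; 0 binders instantiated on Bałaban's densities; NE1′ ⇐ the named binders — NOT
printed, NOT proved; spine PROVED 0∕9.  Rung (B)+1 on ONE finite four-torus — NOT infinite volume, NOT a mass gap, NOT OS on ℝ⁴, NOT Clay.
HONEST DEPENDENCY: continuum YM on T⁴ ⇐ BetaPertH ∧ nine spine estimates (0/9 proved); BetaPertH ⇐ (D1) ∧ (D4) ∧ CAP+tail; G-an2-4
gates asym, D1 and NE2/3/4. -/

noncomputable section

namespace Summit.QuantumFields.BalabanUV.T4Continuum.GaussianLettersRadiusLocated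

open Summit.QuantumFields.BalabanUV.T4Continuum.SubstrateGaussianLettersBall (detBudget)

/-! ## §1 The determinant budget below the located threshold -/

/-- **THE DETERMINANT BUDGET UNDER UNIFORM LETTER BOUNDS**: for `n ≤ m̄`, `0 ≤ β₀ ≤ β̄`, `0 ≤ ϑ ≤ ϑ̄`, `0 ≤ R ≤ 1`,
`detBudget n β₀ ϑ R ≤ m̄!·m̄·max 1 (β̄ + ϑ̄)^{m̄−1}·ϑ̄·R`. [folklore] -/
theorem detBudget_le_located {n mb : ℕ} {β₀ βb ϑ ϑb R : ℝ} (hn : n ≤ mb) (hβ₀ : 0 ≤ β₀) (hβ : β₀ ≤ βb) (hϑ₀ : 0 ≤ ϑ) (hϑ : ϑ ≤ ϑb)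
    (hR₀ : 0 ≤ R) (hR₁ : R ≤ 1) :
    detBudget n β₀ ϑ R ≤ mb.factorial * mb * max 1 (βb + ϑb) ^ (mb - 1) * ϑb * R := by
  have hϑb : 0 ≤ ϑb := hϑ₀.trans hϑ
  have hM₁ : (1 : ℝ) ≤ max 1 (βb + ϑb) := le_max_left _ _
  have hM₀ : (0 : ℝ) ≤ max 1 (βb + ϑb) := zero_le_one.trans hM₁
  have hB₀ : 0 ≤ β₀ + ϑ * R := add_nonneg hβ₀ (mul_nonneg hϑ₀ hR₀)
  have hBM : β₀ + ϑ * R ≤ max 1 (βb + ϑb) :=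
    calc β₀ + ϑ * R ≤ βb + ϑb * 1 := add_le_add hβ (mul_le_mul hϑ hR₁ hR₀ hϑb)
      _ = βb + ϑb := by rw [mul_one]
      _ ≤ max 1 (βb + ϑb) := le_max_right _ _
  have hpow : (β₀ + ϑ * R) ^ (n - 1) ≤ max 1 (βb + ϑb) ^ (mb - 1) :=
    (pow_le_pow_left₀ hB₀ hBM _).trans (pow_le_pow_right₀ hM₁ (Nat.sub_le_sub_right hn 1))
  have hfac : (n.factorial : ℝ) ≤ mb.factorial := by exact_mod_cast Nat.factorial_le hn
  have hnm : (n : ℝ) ≤ mb := by exact_mod_cast hn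
  have hϑR : ϑ * R ≤ ϑb * R := mul_le_mul_of_nonneg_right hϑ hR₀
  calc detBudget n β₀ ϑ R = n.factorial * (n * (β₀ + ϑ * R) ^ (n - 1) * (ϑ * R)) := rfl
    _ ≤ mb.factorial * (mb * max 1 (βb + ϑb) ^ (mb - 1) * (ϑb * R)) := by
        apply mul_le_mul hfac _ (by positivity) (by positivity)
        apply mul_le_mul _ hϑR (by positivity) (by positivity)
        exact mul_le_mul hnm hpow (by positivity) (by positivity)
    _ = mb.factorial * mb * max 1 (βb + ϑb) ^ (mb - 1) * ϑb * R := by ring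

/-- **`hbud`, LOCATED**: under the uniform letter bounds of `detBudget_le_located` and `d̄ ≤ d₀`, the ONE scalar clause
`m̄!·m̄·max 1 (β̄ + ϑ̄)^{m̄−1}·ϑ̄·R < d̄` gives `detBudget n β₀ ϑ R < d₀`. [folklore] -/
theorem detBudget_lt_located {n mb : ℕ} {β₀ βb ϑ ϑb R db d₀ : ℝ} (hn : n ≤ mb) (hβ₀ : 0 ≤ β₀) (hβ : β₀ ≤ βb) (hϑ₀ : 0 ≤ ϑ) (hϑ : ϑ ≤ ϑb)
    (hR₀ : 0 ≤ R) (hR₁ : R ≤ 1) (hRd : mb.factorial * mb * max 1 (βb + ϑb) ^ (mb - 1) * ϑb * R < db) (hd : db ≤ d₀) :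
    detBudget n β₀ ϑ R < d₀ :=
  ((detBudget_le_located hn hβ₀ hβ hϑ₀ hϑ hR₀ hR₁).trans_lt hRd).trans_le hd

/-! ## §2 The margin clause below the located threshold -/

/-- **`hmq`, LOCATED**: `n·ϑ·R < γ` from `n ≤ m̄`, `0 ≤ ϑ ≤ ϑ̄`, `0 ≤ R` and the ONE scalar clause `m̄·ϑ̄·R < γ̄ ≤ γ`. [folklore] -/
theorem card_mul_radius_lt_located {n mb : ℕ} {ϑ ϑb R γb γ : ℝ} (hn : n ≤ mb) (hϑ₀ : 0 ≤ ϑ) (hϑ : ϑ ≤ ϑb) (hR₀ : 0 ≤ R)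
    (hRγ : mb * ϑb * R < γb) (hγ : γb ≤ γ) : n * ϑ * R < γ := by
  have hnm : (n : ℝ) ≤ mb := by exact_mod_cast hn
  have h : (n : ℝ) * ϑ * R ≤ mb * ϑb * R :=
    mul_le_mul_of_nonneg_right (mul_le_mul hnm hϑ hϑ₀ (Nat.cast_nonneg _)) hR₀
  exact (h.trans_lt hRγ).trans_le hγ

/-! ## §3 The two displayed families of S30 ∕ S65 from three scalar clauses per level -/

/-- **THE CLASS OPERATOR RADIUS, LOCATED — BOTH DISPLAYED FAMILIES AT ONCE**: for letters `β₀ ϑ d₀ γ : I → J → ℝ` and multiplicities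
`card : I → J → ℕ` uniformly bounded (`card X j ≤ m̄`, `0 ≤ β₀ X j ≤ β̄`, `0 ≤ ϑ X j ≤ ϑ̄`, `d̄ ≤ d₀ X j`, `γ̄ ≤ γ X j`) and a radius schedule
`R′` with, per level, `0 ≤ R′ k ≤ 1`, `m̄!·m̄·max 1 (β̄ + ϑ̄)^{m̄−1}·ϑ̄·R′ k < d̄`, `m̄·ϑ̄·R′ k < γ̄`: BOTH
`∀ k X j, detBudget (card X j) (β₀ X j) (ϑ X j) (R′ k) < d₀ X j` AND `∀ k X j, card X j·ϑ X j·R′ k < γ X j` — literally the `hbud` ∕ `hmq`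
binder SHAPES of crew S30 §2 ∕ S31 ∕ S65 (at `card X j := Fintype.card (mI X j)`). [folklore] -/
theorem hbud_hmq_located {I J : Type*} {card : I → J → ℕ} {β₀ ϑ d₀ γ : I → J → ℝ} {R' : ℕ → ℝ} {mb : ℕ} {βb ϑb db γb : ℝ}
    (hcard : ∀ X j, card X j ≤ mb) (hβ₀ : ∀ X j, 0 ≤ β₀ X j) (hβ : ∀ X j, β₀ X j ≤ βb) (hϑ₀ : ∀ X j, 0 ≤ ϑ X j) (hϑ : ∀ X j, ϑ X j ≤ ϑb)
    (hd : ∀ X j, db ≤ d₀ X j) (hγ : ∀ X j, γb ≤ γ X j) (hR₀ : ∀ k, 0 ≤ R' k) (hR₁ : ∀ k, R' k ≤ 1)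
    (hRd : ∀ k, mb.factorial * mb * max 1 (βb + ϑb) ^ (mb - 1) * ϑb * R' k < db) (hRγ : ∀ k, mb * ϑb * R' k < γb) :
    (∀ k X j, detBudget (card X j) (β₀ X j) (ϑ X j) (R' k) < d₀ X j) ∧ (∀ k X j, card X j * ϑ X j * R' k < γ X j) :=
  ⟨fun k X j => detBudget_lt_located (hcard X j) (hβ₀ X j) (hβ X j) (hϑ₀ X j) (hϑ X j) (hR₀ k) (hR₁ k) (hRd k) (hd X j),
    fun k X j => card_mul_radius_lt_located (hcard X j) (hϑ₀ X j) (hϑ X j) (hR₀ k) (hRγ k) (hγ X j)⟩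

/-- Located example: one `1 × 1` factor with `β̄ = 2`, `ϑ̄ = 1`, `d̄ = 2`, `γ̄ = 2` (crew W58's letters) — every radius `R′ ≤ 1` with `2R′ < 2`
and `R′ < 2`, e.g. `R′ = 1∕2`, meets both clauses (W58 takes `R′ = 1` with its own margins; here the generic threshold). -/
example : (1 : ℕ).factorial * (1 : ℕ) * max 1 ((2 : ℝ) + 1) ^ (1 - 1) * 1 * (1 / 2 : ℝ) < 2 ∧ (1 : ℕ) * (1 : ℝ) * (1 / 2) < 2 := by
  norm_num

end Summit.QuantumFields.BalabanUV.T4Continuum.GaussianLettersRadiusLocated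

end
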